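import Summits.QuantumFields.GaugeBoot.HaarShiftSupport
import Summits.QuantumFields.GaugeBoot.DiagonalRPTorusPlaquetteSign
import Summits.QuantumFields.GaugeBoot.ClassBHaarShift
import HarnessLib

/-!
# The one-link shift of the Wilson boundary action by a central scalar (gauge-boot, Class B at
`β < 0`, part 1/2)

HONEST FRAMING (cell `pub-gaugeboot`, page 1 of every file): the venture produces certified bounds
on lattice expectations at stated coupling, gauge group, dimension and torus size; NOT a mass gap,
NOT a continuum limit, NOT a string tension; NOT Yang–Mills-summit-bearing (barriers
`FixedCouplingUltralocality`, `PerturbativeInvisibility`). Lemmas for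
`ClassBNegativeCouplingEmpty.lean` (Class B is empty at every `β < 0`); certifies no number.

## Content

`ρ : G → M_N(ℂ)` continuous (`N ≥ 1`) with a central scalar `ρ z = ω • 1`; a link `e` of `ℤ^d`;
`S_e = wilsonBoundaryAction ρ {e}` (the plaquettes through `e`);
`Δ_g(U) = S_e(U[e ↦ g⁻¹U_e]) - S_e(U)` — the exponent of the one-link Haar-shift (DLR) identity
`IsHaarShiftState`.

* `trace_hol_update_add` / `re_trace_hol_update_add` — a plaquette contains each of its links
  exactly once, so `tr ρ(U_p[e ↦ zU_e]) + tr ρ(U_p[e ↦ z⁻¹U_e]) = (ω + ω⁻¹) tr ρ(U_p)`, and in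
  real parts `… = 2 Re ω · Re tr ρ(U_p)` (`|ω| = 1`);
* ★ `shiftAction_add_shiftAction_inv` — POINTWISE `Δ_z + Δ_{z⁻¹} = 2(1 - Re ω) Σ_{p ∋ e} Re tr ρ(U_p)`;
* `continuous_shiftAction`, `isCylinder_shiftAction`;
* ★ `IsHaarShiftState.integral_exp_shiftAction` — the Haar-shift identity on the trivial observable:
  `∫ exp(-β Δ_g) dμ = 1`; ★ `IsHaarShiftState.integral_shiftAction_nonpos` — hence, by
  `e^x ≥ 1 + x`, `∫ Δ_g dμ ≤ 0` whenever `β < 0`.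

Elementary; [folklore] bookkeeping.
-/


open MeasureTheory Complex Finset Function
open scoped ComplexOrder

namespace Summit.QuantumFields.GaugeBoot

open Literature.MathematicalPhysics.QuantumFieldTheory (haarProbability IsSpecialUnitaryModel
  IsUnitaryModel)
open Literature.MathematicalPhysics.QuantumLattice
open Literature.RepresentationTheory.CompactGroups

noncomputable section

variable {d N : ℕ} {G : Type*} [Group G] [TopologicalSpace G] [IsTopologicalGroup G]
  [CompactSpace G] [MeasurableSpace G] [BorelSpace G] (ρ : G →* Matrix (Fin N) (Fin N) ℂ)

/-! ## A central scalar through one link of a plaquette -/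

section Plaquette

omit [TopologicalSpace G] [IsTopologicalGroup G] [CompactSpace G] [MeasurableSpace G] [BorelSpace G] in
/-- If `ρ z = ω • 1` then `ρ z⁻¹ = ω⁻¹ • 1` (`N ≥ 1`). -/
theorem map_inv_eq_smul_one_of_map_eq_smul_one [NeZero N] {z : G} {ω : ℂ}
    (hz : ρ z = ω • (1 : Matrix (Fin N) (Fin N) ℂ)) :
    ρ z⁻¹ = ω⁻¹ • (1 : Matrix (Fin N) (Fin N) ℂ) := by
  have h1 : ρ z⁻¹ * ρ z = 1 := by rw [← map_mul, inv_mul_cancel, map_one]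
  have hω : ω ≠ 0 := by
    intro h0
    rw [hz, h0, zero_smul, Matrix.mul_zero] at h1
    have h00 := congrFun (congrFun h1 0) 0
    simp at h00
  rw [hz, Matrix.mul_smul, Matrix.mul_one] at h1
  calc ρ z⁻¹ = ω⁻¹ • (ω • ρ z⁻¹) := by rw [smul_smul, inv_mul_cancel₀ hω, one_smul]
    _ = ω⁻¹ • (1 : Matrix (Fin N) (Fin N) ℂ) := by rw [h1]

omit [TopologicalSpace G] [IsTopologicalGroup G] [CompactSpace G] [MeasurableSpace G] [BorelSpace G] in
/-- **One link of a plaquette, multiplied by central scalars `z^{±1}`.** For a plaquette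
`p = (x; i, j)` of `ℤ^d` and one of its four links `e`, with `ρ z = ω • 1`:
`tr ρ(U_p[e ↦ zU_e]) + tr ρ(U_p[e ↦ z⁻¹U_e]) = (ω + ω⁻¹) tr ρ(U_p)` (the link enters once,
positively or inverted; either way the pair `{ω, ω⁻¹}` appears). -/
theorem trace_hol_update_add [NeZero N] {z : G} {ω : ℂ}
    (hz : ρ z = ω • (1 : Matrix (Fin N) (Fin N) ℂ)) (p : ZdPlaquette d) {e : ZdEdge d}
    (he : e ∈ plaquetteEdges p) (U : LGConfig d G) :
    (ρ (plaquetteHolonomyZd (Function.update U e (z * U e)) p.1 p.2.1.1 p.2.1.2)).trace +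
      (ρ (plaquetteHolonomyZd (Function.update U e (z⁻¹ * U e)) p.1 p.2.1.1 p.2.1.2)).trace =
      (ω + ω⁻¹) * (ρ (plaquetteHolonomyZd U p.1 p.2.1.1 p.2.1.2)).trace := by
  classical
  obtain ⟨x, ⟨⟨i, j⟩, hij⟩⟩ := p
  have hz' := map_inv_eq_smul_one_of_map_eq_smul_one ρ hz
  have hne : i ≠ j := ne_of_lt hij
  have hvi : x + Pi.single i (1 : ℤ) ≠ x := by
    intro h; have := congrFun h i; simp at this
  have hvj : x + Pi.single j (1 : ℤ) ≠ x := by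
    intro h; have := congrFun h j; simp at this
  -- the four (distinct) edges
  have hab : ((x, i) : ZdEdge d) ≠ (x + Pi.single i 1, j) := fun h => hne (congrArg Prod.snd h)
  have hac : ((x, i) : ZdEdge d) ≠ (x + Pi.single j 1, i) := fun h => hvj (congrArg Prod.fst h).symm
  have had : ((x, i) : ZdEdge d) ≠ (x, j) := fun h => hne (congrArg Prod.snd h)
  have hbc : ((x + Pi.single i 1, j) : ZdEdge d) ≠ (x + Pi.single j 1, i) :=
    fun h => hne (congrArg Prod.snd h).symm
  have hbd : ((x + Pi.single i 1, j) : ZdEdge d) ≠ (x, j) := fun h => hvi (congrArg Prod.fst h)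
  have hcd : ((x + Pi.single j 1, i) : ZdEdge d) ≠ (x, j) := fun h => hne (congrArg Prod.snd h)
  simp only [plaquetteEdges, Finset.mem_insert, Finset.mem_singleton] at he
  simp only
  rcases he with rfl | rfl | rfl | rfl
  · -- `e = (x, i)`, positively oriented, first factor
    simp only [plaquetteHolonomyZd, Function.update_self, Function.update_of_ne hab.symm,
      Function.update_of_ne hac.symm, Function.update_of_ne had.symm, map_mul, hz, hz',
      Matrix.smul_mul, Matrix.one_mul, Matrix.trace_smul, smul_eq_mul]
    ring
  · -- `e = (x + e_i, j)`, positively oriented, second factor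
    simp only [plaquetteHolonomyZd, Function.update_self, Function.update_of_ne hab,
      Function.update_of_ne hbc.symm, Function.update_of_ne hbd.symm, map_mul, hz, hz',
      Matrix.smul_mul, Matrix.mul_smul, Matrix.one_mul, Matrix.trace_smul, smul_eq_mul]
    ring
  · -- `e = (x + e_j, i)`, inverted, third factor
    simp only [plaquetteHolonomyZd, Function.update_self, Function.update_of_ne hac,
      Function.update_of_ne hbc, Function.update_of_ne hcd.symm, mul_inv_rev, inv_inv, map_mul,
      hz, hz', Matrix.smul_mul, Matrix.mul_smul, Matrix.mul_one, Matrix.trace_smul,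
      smul_eq_mul]
    ring
  · -- `e = (x, j)`, inverted, fourth factor
    simp only [plaquetteHolonomyZd, Function.update_self, Function.update_of_ne had,
      Function.update_of_ne hbd, Function.update_of_ne hcd, mul_inv_rev, inv_inv, map_mul, hz, hz',
      Matrix.mul_smul, Matrix.mul_one, Matrix.trace_smul, smul_eq_mul]
    ring

omit [MeasurableSpace G] [BorelSpace G] in
/-- Real parts: `Re tr ρ(U_p[e ↦ zU_e]) + Re tr ρ(U_p[e ↦ z⁻¹U_e]) = 2 Re ω · Re tr ρ(U_p)`
(`|ω| = 1`, automatic for a compact group). -/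
theorem re_trace_hol_update_add [NeZero N] (hρ : Continuous ρ) {z : G} {ω : ℂ}
    (hz : ρ z = ω • (1 : Matrix (Fin N) (Fin N) ℂ)) (p : ZdPlaquette d) {e : ZdEdge d}
    (he : e ∈ plaquetteEdges p) (U : LGConfig d G) :
    plaquetteObs ρ p.1 p.2.1.1 p.2.1.2 (Function.update U e (z * U e)) +
      plaquetteObs ρ p.1 p.2.1.1 p.2.1.2 (Function.update U e (z⁻¹ * U e)) =
      2 * ω.re * plaquetteObs ρ p.1 p.2.1.1 p.2.1.2 U := by
  have hω1 : ‖ω‖ = 1 := norm_eq_one_of_map_eq_smul_one ρ hρ hz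
  have hinv : ω⁻¹ = (starRingEnd ℂ) ω := by
    rw [Complex.inv_def, Complex.normSq_eq_norm_sq, hω1]; simp
  have h := congrArg Complex.re (trace_hol_update_add ρ hz p he U)
  rw [Complex.add_re] at h
  simp only [plaquetteObs]
  rw [h, hinv, Complex.mul_re, Complex.add_re, Complex.add_im, Complex.conj_re, Complex.conj_im]
  ring

end Plaquette

/-! ## The one-link shift of the boundary action at a central scalar -/

section Shift

variable [NeZero N]

omit [MeasurableSpace G] [BorelSpace G] in
/-- ★ **Pointwise identity.** With `S_e = wilsonBoundaryAction ρ {e}` and `Δ_g(U) = S_e(U[e ↦ g⁻¹U_e]) - S_e(U)`: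
`Δ_z(U) + Δ_{z⁻¹}(U) = 2 (1 - Re ω) · Σ_{p ∋ e} Re tr ρ(U_p)`. -/
theorem shiftAction_add_shiftAction_inv (hρ : Continuous ρ) {z : G} {ω : ℂ}
    (hz : ρ z = ω • (1 : Matrix (Fin N) (Fin N) ℂ)) (e : ZdEdge d) (U : LGConfig d G) :
    (wilsonBoundaryAction ρ {e} (Function.update U e (z⁻¹ * U e)) - wilsonBoundaryAction ρ {e} U) +
      (wilsonBoundaryAction ρ {e} (Function.update U e (z⁻¹⁻¹ * U e)) -
        wilsonBoundaryAction ρ {e} U) =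
      2 * (1 - ω.re) * ∑ p ∈ plaquettesTouching ({e} : Finset (ZdEdge d)),
        plaquetteObs ρ p.1 p.2.1.1 p.2.1.2 U := by
  rw [inv_inv]
  simp only [wilsonBoundaryAction]
  have hsum : ∀ V : LGConfig d G, ∑ p ∈ plaquettesTouching ({e} : Finset (ZdEdge d)),
      ((N : ℝ) - plaquetteObs ρ p.1 p.2.1.1 p.2.1.2 V) =
      (plaquettesTouching ({e} : Finset (ZdEdge d))).card * (N : ℝ) -
        ∑ p ∈ plaquettesTouching ({e} : Finset (ZdEdge d)), plaquetteObs ρ p.1 p.2.1.1 p.2.1.2 V :=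
    fun V => by rw [Finset.sum_sub_distrib, Finset.sum_const, nsmul_eq_mul]
  rw [hsum, hsum, hsum]
  have hpair : ∑ p ∈ plaquettesTouching ({e} : Finset (ZdEdge d)),
      plaquetteObs ρ p.1 p.2.1.1 p.2.1.2 (Function.update U e (z⁻¹ * U e)) +
      ∑ p ∈ plaquettesTouching ({e} : Finset (ZdEdge d)),
        plaquetteObs ρ p.1 p.2.1.1 p.2.1.2 (Function.update U e (z * U e)) =
      ∑ p ∈ plaquettesTouching ({e} : Finset (ZdEdge d)),
        2 * ω.re * plaquetteObs ρ p.1 p.2.1.1 p.2.1.2 U := by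
    rw [← Finset.sum_add_distrib]
    refine Finset.sum_congr rfl fun p hp => ?_
    have he : e ∈ plaquetteEdges p := by
      obtain ⟨e', he'⟩ := mem_plaquettesTouching_iff.1 hp
      rw [Finset.mem_inter, Finset.mem_singleton] at he'
      exact he'.2 ▸ he'.1
    rw [add_comm]
    exact re_trace_hol_update_add ρ hρ hz p he U
  have hlin : ∑ p ∈ plaquettesTouching ({e} : Finset (ZdEdge d)),
      2 * ω.re * plaquetteObs ρ p.1 p.2.1.1 p.2.1.2 U =
      2 * ω.re * ∑ p ∈ plaquettesTouching ({e} : Finset (ZdEdge d)),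
        plaquetteObs ρ p.1 p.2.1.1 p.2.1.2 U := by rw [Finset.mul_sum]
  linear_combination (-1 : ℝ) * hpair - hlin

variable [SecondCountableTopology G]

omit [CompactSpace G] [MeasurableSpace G] [BorelSpace G] [NeZero N] [SecondCountableTopology G] in
/-- The one-link shift of the boundary action is a continuous function of the configuration. -/
theorem continuous_shiftAction (hρ : Continuous ρ) (e : ZdEdge d) (g : G) :
    Continuous fun U : LGConfig d G =>
      wilsonBoundaryAction ρ {e} (Function.update U e (g⁻¹ * U e)) - wilsonBoundaryAction ρ {e} U :=
  ((continuous_wilsonBoundaryAction ρ hρ {e}).comp (continuous_update_mul e g⁻¹)).sub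
    (continuous_wilsonBoundaryAction ρ hρ {e})

omit [TopologicalSpace G] [IsTopologicalGroup G] [CompactSpace G] [MeasurableSpace G] [BorelSpace G]
  [SecondCountableTopology G] [NeZero N] in
/-- The one-link shift of the boundary action is a cylinder observable. -/
theorem isCylinder_shiftAction (e : ZdEdge d) (g : G) :
    IsCylinder (fun U : LGConfig d G =>
      wilsonBoundaryAction ρ {e} (Function.update U e (g⁻¹ * U e)) - wilsonBoundaryAction ρ {e} U)
      (insert e ((plaquettesTouching ({e} : Finset (ZdEdge d))).biUnion plaquetteEdges)) := by
  intro U V hUV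
  have hS := isCylinder_wilsonBoundaryAction_holds (G := G) ρ ({e} : Finset (ZdEdge d))
  have h1 : wilsonBoundaryAction ρ {e} U = wilsonBoundaryAction ρ {e} V :=
    hS fun x hx => hUV x (Finset.mem_insert_of_mem hx)
  have h2 : wilsonBoundaryAction ρ {e} (Function.update U e (g⁻¹ * U e)) =
      wilsonBoundaryAction ρ {e} (Function.update V e (g⁻¹ * V e)) := by
    refine hS fun x hx => ?_
    by_cases hxe : x = e
    · subst hxe; simp only [Function.update_self, hUV x (Finset.mem_insert_self _ _)]
    · simp only [Function.update_of_ne hxe, hUV x (Finset.mem_insert_of_mem hx)]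
  simp only [h1, h2]

omit [IsTopologicalGroup G] [CompactSpace G] [BorelSpace G] [NeZero N] [SecondCountableTopology G] in
/-- ★ **Haar-shift with the trivial observable**: `∫ exp(-β Δ_g) dμ = 1` for a probability
Haar-shift state, every link `e` and every `g`. -/
theorem IsHaarShiftState.integral_exp_shiftAction {β : ℝ} {μ : Measure (LGConfig d G)}
    [IsProbabilityMeasure μ] (hμ : IsHaarShiftState ρ β μ) (e : ZdEdge d) (g : G) :
    ∫ U, Real.exp (-(β * (wilsonBoundaryAction ρ {e} (Function.update U e (g⁻¹ * U e)) -
      wilsonBoundaryAction ρ {e} U))) ∂μ = 1 := by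
  have h := hμ e g (fun _ => (1 : ℝ)) ∅ (fun _ _ _ => rfl) continuous_const
  simp only [integral_const, probReal_univ, smul_eq_mul, mul_one, one_mul] at h
  exact h.symm

omit [NeZero N] in
/-- ★ **… hence `∫ Δ_g dμ ≤ 0` at `β < 0`** (`e^x ≥ 1 + x`). -/
theorem IsHaarShiftState.integral_shiftAction_nonpos (hρ : Continuous ρ) {β : ℝ} (hβ : β < 0)
    {μ : Measure (LGConfig d G)} [IsProbabilityMeasure μ] (hμ : IsHaarShiftState ρ β μ)
    (e : ZdEdge d) (g : G) :
    ∫ U, (wilsonBoundaryAction ρ {e} (Function.update U e (g⁻¹ * U e)) -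
      wilsonBoundaryAction ρ {e} U) ∂μ ≤ 0 := by
  set Δ : LGConfig d G → ℝ := fun U =>
    wilsonBoundaryAction ρ {e} (Function.update U e (g⁻¹ * U e)) - wilsonBoundaryAction ρ {e} U
    with hΔ
  have hΔc : Continuous Δ := continuous_shiftAction ρ hρ e g
  have hΔi : Integrable Δ μ := integrable_of_continuous_real hΔc μ
  have hexp := hμ.integral_exp_shiftAction ρ e g
  -- `1 + (-β) Δ ≤ exp(-β Δ)` pointwise, integrate
  have hle : ∫ U, (1 + (-β) * Δ U) ∂μ ≤ ∫ U, Real.exp (-(β * Δ U)) ∂μ := by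
    refine integral_mono ((integrable_const _).add (hΔi.const_mul _))
      (integrable_of_continuous_real (Real.continuous_exp.comp ((hΔc.const_mul β).neg)) μ)
      fun U => ?_
    have h := Real.add_one_le_exp (-(β * Δ U))
    simp only
    linarith
  rw [integral_add (integrable_const _) (hΔi.const_mul _), integral_const, probReal_univ,
    integral_const_mul] at hle
  simp only [smul_eq_mul, mul_one] at hle
  change ∫ U, Δ U ∂μ ≤ 0
  have hexp' : ∫ U, Real.exp (-(β * Δ U)) ∂μ = 1 := hexp
  rw [hexp'] at hle
  nlinarith

end Shift

end

end Summit.QuantumFields.GaugeBoot
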